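import Literature.NumberTheory.GaloisRepresentations.LocalKroneckerWeberInertiaProofs
import HarnessLib

/-!
# Orders of abelian characters on the inertia group of `ℚ_p`; at `p = 2` odd order means unramified

Topic `Literature/NumberTheory/GaloisRepresentations`; namespace
`Literature.NumberTheory.GaloisRepresentations`.  A theorems-only file (no definition, no named
fact; D-0026), corollaries of the tree's local Kronecker–Weber theorem in inertia form
`adicCompletion_rat_exists_eq_comp_cyclotomicCharacter_of_mem_absInertia`
(`LocalKroneckerWeberInertiaProofs`; Serre, *Local Fields*, XIV §7 Thm. 2: on the inertia group
`I_{ℚ_v}` of the completion `ℚ_v` of `ℚ` at `v ∣ p`, every homomorphism `Λ : Γ_{ℚ_v} → M`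
with open kernel and commutative image factors through `χ_p mod p^m : I_{ℚ_v} → (ℤ/p^m)ˣ`).

* `adicCompletion_rat_exists_pow_eq_one_of_mem_absInertia` — hence the values of `Λ` on inertia
  are killed by `φ(p^m) = p^{m-1}(p-1)` for some `m ≥ 1` (Euler–Fermat in `(ℤ/p^m)ˣ`,
  `ZMod.pow_totient`): the abelianised inertia group of `ℚ_p` is `ℤ_pˣ ≅ μ_{p-1} × (1 + pℤ_p)`
  (resp. `{±1} × (1 + 4ℤ₂)`), a pro-`p` group times a cyclic group of order `p - 1`;
* `adicCompletion_rat_eq_one_of_mem_absInertia_of_pow_eq_one` — so if the values of `Λ` on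
  inertia are also killed by some `n` prime to `p` and to `p - 1`, then `Λ` is trivial on
  inertia (**unramified**);
* `adicCompletion_rat_eq_one_of_mem_absInertia_of_odd` — **at `p = 2`: an abelian character of
  `Γ_{ℚ₂}` (open kernel) whose values on inertia have odd order is unramified**, since
  `ℤ₂ˣ = 1 + 2ℤ₂` is pro-`2`.  This is the dyadic accident behind the weight-one step of
  Allen 2014, Lemma 87 over `ℚ` (arXiv:1301.1113v2, p. 70): the Teichmüller lift `ρ₁ = Ind χ` of a
  mod-`2` dihedral `ρ̄` has entries in odd-order roots of unity, so wherever the inertia group at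
  `2` lands in the index-two subgroup `G_L` (i.e. `2` unramified in `L`) the diagonal characters
  `χ_v, χ'_v` of `ρ₁|_{G_{ℚ₂}}` are unramified and the weight-one form of `ρ₁` has level prime
  to `2`.
* `adicCompletion_rat_exists_monoidHom_apply_absGaloisRestrict_eq_of_mem_absInertia` —
  **globalisation**: every abelian character `Λ` of `Γ_{ℚ_p}` (open kernel) agrees on inertia
  with a global finite-order character `η = g ∘ (χ_p mod p^m)` of `Γ_ℚ` (open kernel,
  commutative image, killed by `φ(p^m)`), `χ_p` the global `p`-adic cyclotomic character — the
  Dirichlet character of `p`-power conductor with prescribed inertial restriction at `p`.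

## References

* J.-P. Serre, *Local Fields*, GTM 67 (1979), Ch. XIV §7, Thm. 2; Ch. IV §4, Prop. 17.
  [SerreLocalFields1979]
* P. B. Allen, Compositio Math. 150 (2014) = arXiv:1301.1113v2, §5.1.1, Lemma 87. [Allen2014]
-/

noncomputable section

open scoped NumberField
open Field IsDedekindDomain

namespace Literature.NumberTheory.GaloisRepresentations

variable (p : ℕ) [Fact p.Prime] (v : HeightOneSpectrum (𝓞 ℚ))

/-- **The values of an abelian character of `Γ_{ℚ_p}` on inertia are killed by `φ(p^m)` for
some `m ≥ 1`** (local Kronecker–Weber in inertia form, plus Euler–Fermat in `(ℤ/p^m)ˣ`).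
[cite: SerreLocalFields1979, Ch. XIV §7 Thm. 2] -/
theorem adicCompletion_rat_exists_pow_eq_one_of_mem_absInertia
    (hv : (Rat.HeightOneSpectrum.primesEquiv v : ℕ) = p) {M : Type*} [Group M]
    (Λ : absoluteGaloisGroup (v.adicCompletion ℚ) →* M)
    (hopen : IsOpen ((Λ.ker : Subgroup (absoluteGaloisGroup (v.adicCompletion ℚ))) :
      Set (absoluteGaloisGroup (v.adicCompletion ℚ))))
    (hcomm : ∀ a b, Λ a * Λ b = Λ b * Λ a) :
    ∃ m : ℕ, 0 < m ∧ ∀ σ ∈ absInertia (v.adicCompletion ℚ),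
      Λ σ ^ (p ^ (m - 1) * (p - 1)) = 1 := by
  obtain ⟨m, hm, g, hg⟩ :=
    adicCompletion_rat_exists_eq_comp_cyclotomicCharacter_of_mem_absInertia p v hv Λ hopen hcomm
  refine ⟨m, hm, fun σ hσ => ?_⟩
  rw [hg σ hσ, ← map_pow, ← Nat.totient_prime_pow Fact.out hm, ZMod.pow_totient, map_one]

/-- **Unramifiedness from the order of the values on inertia.**  If an abelian character `Λ` of
`Γ_{ℚ_p}` (open kernel) takes on inertia values killed by some `n` prime to `p` and to `p - 1`,
then `Λ` is trivial on inertia. [cite: SerreLocalFields1979, Ch. XIV §7 Thm. 2] -/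
theorem adicCompletion_rat_eq_one_of_mem_absInertia_of_pow_eq_one
    (hv : (Rat.HeightOneSpectrum.primesEquiv v : ℕ) = p) {M : Type*} [Group M]
    (Λ : absoluteGaloisGroup (v.adicCompletion ℚ) →* M)
    (hopen : IsOpen ((Λ.ker : Subgroup (absoluteGaloisGroup (v.adicCompletion ℚ))) :
      Set (absoluteGaloisGroup (v.adicCompletion ℚ))))
    (hcomm : ∀ a b, Λ a * Λ b = Λ b * Λ a) {n : ℕ} (hnp : n.Coprime p) (hnp' : n.Coprime (p - 1))
    (hn : ∀ σ ∈ absInertia (v.adicCompletion ℚ), Λ σ ^ n = 1) :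
    ∀ σ ∈ absInertia (v.adicCompletion ℚ), Λ σ = 1 := by
  obtain ⟨m, hm, hpow⟩ := adicCompletion_rat_exists_pow_eq_one_of_mem_absInertia p v hv Λ hopen hcomm
  intro σ hσ
  have hcop : n.Coprime (p ^ (m - 1) * (p - 1)) :=
    Nat.Coprime.mul_right (Nat.Coprime.pow_right _ hnp) hnp'
  have h := (pow_gcd_eq_one (a := Λ σ) (m := n) (n := p ^ (m - 1) * (p - 1))).mpr
    ⟨hn σ hσ, hpow σ hσ⟩
  rwa [Nat.Coprime.gcd_eq_one hcop, pow_one] at h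

/-- **At `p = 2`, odd order on inertia means unramified**: an abelian character `Λ` of `Γ_{ℚ₂}`
(open kernel) whose values on inertia are killed by an odd `n` is trivial on inertia — the
abelianised inertia group `ℤ₂ˣ = 1 + 2ℤ₂` of `ℚ₂` is a pro-`2` group.
[cite: SerreLocalFields1979, Ch. XIV §7 Thm. 2 (with Ch. IV §4 Prop. 17)] -/
theorem adicCompletion_rat_eq_one_of_mem_absInertia_of_odd [Fact (Nat.Prime 2)]
    (hv : (Rat.HeightOneSpectrum.primesEquiv v : ℕ) = 2) {M : Type*} [Group M]
    (Λ : absoluteGaloisGroup (v.adicCompletion ℚ) →* M)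
    (hopen : IsOpen ((Λ.ker : Subgroup (absoluteGaloisGroup (v.adicCompletion ℚ))) :
      Set (absoluteGaloisGroup (v.adicCompletion ℚ))))
    (hcomm : ∀ a b, Λ a * Λ b = Λ b * Λ a) {n : ℕ} (hodd : Odd n)
    (hn : ∀ σ ∈ absInertia (v.adicCompletion ℚ), Λ σ ^ n = 1) :
    ∀ σ ∈ absInertia (v.adicCompletion ℚ), Λ σ = 1 :=
  adicCompletion_rat_eq_one_of_mem_absInertia_of_pow_eq_one 2 v hv Λ hopen hcomm
    (Nat.coprime_two_right.2 hodd) (Nat.coprime_one_right n) hn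

/-! ### Globalising a character of the inertia group of `ℚ_p` -/

/-- **Every abelian character of `Γ_{ℚ_p}` agrees on inertia with a GLOBAL finite-order character
of `Γ_ℚ`** (local Kronecker–Weber in inertia form + the global cyclotomic character): for
`Λ : Γ_{ℚ_v} → M` with open kernel and commutative image there are `m ≥ 1` and a homomorphism
`η : Γ_ℚ → M` with open kernel, commutative image, values killed by `φ(p^m)`, and
`η(res σ) = Λ(σ)` for every `σ` in the inertia group `I_{ℚ_v}` — namely
`η = g ∘ (χ_p mod p^m)` where `Λ|_I = g ∘ (χ_p mod p^m)` and `χ_p` is the `p`-adic cyclotomic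
character of `Γ_ℚ` (`χ_p ∘ res = χ_p`, `cyclotomicCharacter_absGaloisRestrict`).  This is the
existence of the Dirichlet character of `p`-power conductor with prescribed restriction to the
inertia group at `p` (e.g. the twist making a principal-series weight-one form ordinary at `p`).
[cite: SerreLocalFields1979, Ch. XIV §7 Thm. 2] [cite: Washington1997, Thm. 14.2] -/
theorem adicCompletion_rat_exists_monoidHom_apply_absGaloisRestrict_eq_of_mem_absInertia
    (hv : (Rat.HeightOneSpectrum.primesEquiv v : ℕ) = p) {M : Type*} [Group M]
    (Λ : absoluteGaloisGroup (v.adicCompletion ℚ) →* M)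
    (hopen : IsOpen ((Λ.ker : Subgroup (absoluteGaloisGroup (v.adicCompletion ℚ))) :
      Set (absoluteGaloisGroup (v.adicCompletion ℚ))))
    (hcomm : ∀ a b, Λ a * Λ b = Λ b * Λ a) :
    ∃ (m : ℕ) (η : absoluteGaloisGroup ℚ →* M), 0 < m ∧
      IsOpen ((η.ker : Subgroup (absoluteGaloisGroup ℚ)) : Set (absoluteGaloisGroup ℚ)) ∧
      (∀ a b, η a * η b = η b * η a) ∧
      (∀ σ, η σ ^ (p ^ (m - 1) * (p - 1)) = 1) ∧
      ∀ σ ∈ absInertia (v.adicCompletion ℚ),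
        η (absGaloisRestrict ℚ (v.adicCompletion ℚ) σ) = Λ σ := by
  classical
  haveI : NeZero (p : ℚ) := ⟨Nat.cast_ne_zero.mpr (Fact.out : p.Prime).ne_zero⟩
  obtain ⟨m, hm, g, hg⟩ :=
    adicCompletion_rat_exists_eq_comp_cyclotomicCharacter_of_mem_absInertia p v hv Λ hopen hcomm
  let r : ℤ_[p]ˣ →* (ZMod (p ^ m))ˣ := Units.map (PadicInt.toZModPow m).toMonoidHom
  let χ : absoluteGaloisGroup ℚ →* ℤ_[p]ˣ := (GaloisRep.cyclotomicCharacter ℚ p).toMonoidHom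
  let η : absoluteGaloisGroup ℚ →* M := g.comp (r.comp χ)
  have hη : ∀ σ, η σ = g (r (GaloisRep.cyclotomicCharacter ℚ p σ)) := fun σ => rfl
  refine ⟨m, η, hm, ?_, fun a b => ?_, fun σ => ?_, fun σ hσ => ?_⟩
  · -- the kernel contains the open set `{σ | χ_p(σ) ≡ 1 (mod p^m)}`
    have hcont : Continuous fun σ : absoluteGaloisGroup ℚ =>
        PadicInt.toZModPow m ((GaloisRep.cyclotomicCharacter ℚ p σ : ℤ_[p]ˣ) : ℤ_[p]) :=
      (PadicInt.continuous_toZModPow p m).comp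
        (Units.continuous_val.comp (GaloisRep.cyclotomicCharacter ℚ p).continuous_toFun)
    have hopen1 : IsOpen ((fun σ : absoluteGaloisGroup ℚ =>
        PadicInt.toZModPow m ((GaloisRep.cyclotomicCharacter ℚ p σ : ℤ_[p]ˣ) : ℤ_[p])) ⁻¹' {1}) :=
      (isOpen_discrete _).preimage hcont
    have hle : (r.comp χ).ker ≤ η.ker := fun σ hσ' => by
      rw [MonoidHom.mem_ker] at hσ' ⊢
      rw [hη]
      change g ((r.comp χ) σ) = 1
      rw [hσ', map_one]
    refine Subgroup.isOpen_mono hle ?_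
    convert hopen1 using 1
    ext σ
    rw [SetLike.mem_coe, MonoidHom.mem_ker, Set.mem_preimage, Set.mem_singleton_iff,
      MonoidHom.comp_apply]
    have eχ : χ σ = GaloisRep.cyclotomicCharacter ℚ p σ := rfl
    constructor
    · intro h1
      have := congrArg (fun u : (ZMod (p ^ m))ˣ => (u : ZMod (p ^ m))) h1
      simpa [r, eχ] using this
    · intro h1
      refine Units.ext ?_
      simpa [r, eχ] using h1
  · rw [hη, hη, ← map_mul, ← map_mul, mul_comm, map_mul, map_mul]
  · rw [hη, ← map_pow, ← Nat.totient_prime_pow Fact.out hm, ZMod.pow_totient, map_one]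
  · rw [hη, hg σ hσ, cyclotomicCharacter_absGaloisRestrict ℚ (v.adicCompletion ℚ) p σ]

end Literature.NumberTheory.GaloisRepresentations

end
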